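import Summits.NavierStokesRegularity.NavierStokesRegularity.Theorems.ExtremiserTransienceKStarAttainedHalfSpaceVariation
import HarnessLib

/-!
# Route `ExtremiserTransience`, LINE g6-γ «bang-bang core» (crux `RegularisedNearPlateauStability`,
# stmt-NavierStokesRegularity-28317; parent crux `NearExtremalTransiencePerFlow`, stmt-NavierStokesRegularity-26567):
# THE LINE'S VOCABULARY

The file-local abbreviations of the registered skeleton `Cruxes/NearExtremalTransiencePerFlow/Lines/bangbang_core.lean`
(§0 there), VERBATIM, so that the registered stubs (`stub_densitySupBound`, `stub_efficientCore`, `stub_localBangBang`)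
can be stated by name + signature in `Theorems/` files (a `Cruxes/` file is not importable from `Theorems/`).
All five are abbreviations over the tree's `KStar.HalfSpace` definitions `kStar, Jst, Zen, Wpa, J1, A1, C1` and the
route's literal admissibility class; nothing new is posited:

* `lam v = √(Z/W)` — the Taylor-type length of `v` (`Z = ‖curl v‖₂²`, `W = ‖∇ curl v‖₂²`);
* `ell v M φ = 2J·J₁(φ) − 2κ⋆²M²(W·a₁(φ) + Z·c₁(φ))` — the first variation of `J² − κ⋆²M²ZW` along `φ`;
* `IsAdm v M B` — the route's admissible class (`C^∞`, divergence free, `‖v‖ ≤ M`, `‖Dv‖ ≤ B`, `D⁰v, D¹v, D²v ∈ L²`);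
* `IsReg A v M` — parabolic regularity at budget `A`: `‖Dʲv‖ ≤ A_j·M·λ^{-j}` for all `j`;
* `IsDensity v M G` — `G` is a continuous Euler–Lagrange density: `ell v M (curl η) = ∫⟪G, η⟫` for test fields `η`.

Author: prover seat `ns-net-p2` (g0). HONEST FRAMING: definitions only; no summit is proved by a line.
-/

noncomputable section

open MeasureTheory
open scoped InnerProductSpace RealInnerProductSpace ENNReal ContDiff
open Literature.Analysis.FluidPDE
open Summit.NavierStokesRegularity.NavierStokesRegularity.Theorems.DepletionLadder.KStar.HalfSpace

namespace Summit.NavierStokesRegularity.NavierStokesRegularity.Theorems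

-- the problem directory repeats the summit name (`NavierStokesRegularity/NavierStokesRegularity`)
set_option linter.dupNamespace false

namespace DepletionLadder.KStar.BangBang

/-- The Taylor-type length `λ(v) = √(Z/W)` of a field `v` (`Z = Zen v = ‖curl v‖₂²`, `W = Wpa v = ‖∇ curl v‖₂²`);
verbatim the skeleton's `BangBangCore.lam`. -/
def lam (v : E3 → E3) : ℝ := Real.sqrt (Zen v / Wpa v)

/-- FIRST VARIATION of `f(s) = J(v+sφ)² − κ⋆²M²Z(v+sφ)W(v+sφ)` at `s = 0` along `φ`:
`ℓ_v(φ) = 2J·J₁(φ) − 2κ⋆²M²(W·a₁(φ) + Z·c₁(φ))`; verbatim the skeleton's `BangBangCore.ell`. -/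
def ell (v : E3 → E3) (M : ℝ) (φ : E3 → E3) : ℝ :=
  2 * Jst v * J1 v φ - 2 * kStar ^ 2 * M ^ 2 * (Wpa v * A1 v φ + Zen v * C1 v φ)

/-- The admissible class of the route's set `V` (smooth, divergence-free, `‖v‖ ≤ M`, `‖∇v‖ ≤ B`, `H⁰, H¹, H²` finite);
verbatim the skeleton's `BangBangCore.IsAdm`. -/
def IsAdm (v : E3 → E3) (M B : ℝ) : Prop :=
  ContDiff ℝ (⊤ : ℕ∞) v ∧ VectorCalculus.IsDivFree v ∧ (∀ x, ‖v x‖ ≤ M) ∧ (∀ x, ‖fderiv ℝ v x‖ ≤ B) ∧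
    (∫⁻ x, ‖iteratedFDeriv ℝ 0 v x‖ₑ ^ 2 < ⊤) ∧ (∫⁻ x, ‖iteratedFDeriv ℝ 1 v x‖ₑ ^ 2 < ⊤) ∧
    (∫⁻ x, ‖iteratedFDeriv ℝ 2 v x‖ₑ ^ 2 < ⊤)

/-- PARABOLIC REGULARITY at budget `A` (the class of 28317): `‖Dʲv‖_∞ ≤ A_j · M · λ^{-j}` for every `j`;
verbatim the skeleton's `BangBangCore.IsReg`. -/
def IsReg (A : ℕ → ℝ) (v : E3 → E3) (M : ℝ) : Prop :=
  ∀ (j : ℕ) (x : E3), ‖iteratedFDeriv ℝ j v x‖ ≤ A j * M * (lam v)⁻¹ ^ j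

/-- `G` is an Euler–Lagrange DENSITY for `v` at level `M`: continuous, and `ℓ_v(curl η) = ∫⟪G, η⟫` for every test
field `η`; verbatim the skeleton's `BangBangCore.IsDensity` (existence: `KStar.exists_density`; a sup bound in the
A-regular class: `BangBang.densitySupBound`). -/
def IsDensity (v : E3 → E3) (M : ℝ) (G : E3 → E3) : Prop :=
  Continuous G ∧ ∀ η : E3 → E3, ContDiff ℝ ∞ η → HasCompactSupport η → ell v M (curl η) = ∫ x, ⟪G x, η x⟫_ℝ

end DepletionLadder.KStar.BangBang

end Summit.NavierStokesRegularity.NavierStokesRegularity.Theorems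

end
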